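import Summits.ResolutionOfSingularities.ResolutionOfSingularities.Theorems.StallVertexFlatClasses
import HarnessLib

/-!
# StallVertexNullClasses — decomp-res node «StallVertex» (lens-5 g22 rev 7/8), add-on tree file 21 of the node

Content VERBATIM from the decomp-res lens-5 file `HOME/decomp-res-lens-5/g22/StallVertex.lean` rev 8 (pin 9799ca34,
4 539 l; rev 8 = rev 7 25c16fe6 +
five pure insertions §1j/§1k/§2d/§3i/§4i/§4j; rev 7 = pure insertions §2c/§4h over the landed rev-6 content
95ed6f6f — all earlier statements
byte-identical (critic machine diffs, CRITIC-LEDGER rows 142g / 142h); HOME = run/shared/lean/pub/decomp-res).  The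
rev-0…6 sections are ALREADY in the
tree (`StallVertexForms` / `Kernels` / `Walk` / `Classes` / `Clean` / `Rigid` / `Lines` / `RigidClasses` / `Carry` /
`OldLetter` / `LineTurn` /
`LetterClasses` / `Regime` / `StraightClasses` + wiring `MaxContactCutStallVertex` /
`MaxContactCutStallVertexEvents`, writer g7/g8); the rev-7/8 add-on
files carry ONLY the 53 declarations NEW in rev 7 / rev 8.  Critic: CRITIC-LEDGER row 142g (rev 7, DECIDED +1 (Y):
THE DEFICIENCY LAW — the positive
young-monomial regime is EMPTY, positive differential shade is an interference phenomenon, exact re-location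
`monomialRegime_iff_flat`; inhabitants
T-regime 3 353/116; 2026-08-30T23:43:05Z) and row 142h (rev 8, BOOKED 0: RESONANCE / ECHO / NULL / COINCIDENCE laws
+ the exact two-leaf split
`defectWalksDeep_iff_positive_nullFlat`; 2026-08-31T00:03:14Z) — landing orders INBOX :525 / :543.  Landed by
decomp-res writer g9 as
`StallVertexEcho` (§1j + §1k + §3i), `StallVertexDeficiency` (§2c + §2d), `StallVertexDeficiencyLaw` (§4h
kernels: `FlatMonomialAt` … `muTilde_eq_zero_of_regime`),
`StallVertexFlatClasses` (§4h cells and exact re-locations), `StallVertexNullClasses` (§4i + §4j cells and exact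
re-locations) and the wiring file
`MaxContactCutStallVertexFlat` (every new `closes_…` / `defectWalksDeep_iff_…` BY NAME on
`MaxContactCut.DefectWalksDeep`).  All
`--supports stmt-ResolutionOfSingularities-31770`.  Every file of the node is in the Theses cone (the lens imports
the in-cone `DifferentialShade`), so the
located residual is booked on the route by RE-LOCATING the existing aside 28122 `CFNoSkewJointTailsDeep` (informal-only edit) to
`StallVertex.NoFlatRegimeSkewStalledTailsDeep` ≡ `NoPositiveSkewStalledTailsDeep ∧
NoNullFlatSkewStalledTailsDeep` (EXACT, hypothesis-free chain
skew ↔ … ↔ monomialRegime ↔ flat ↔ positive ∧ nullFlat: `skew_iff_flat`, `skew_iff_positive_nullFlat`)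
— one aside on this column (critic rows 142g/142h:
«file only the newest, exactly one aside on the column; decided cells and the μ̃-sign leaves NOT filed»).

§4i (rev 8, `section Classes`) THE ECHO LAW ON THE TAILS: `moves_after_interference`, `positive_tails_echo`; §4j
(rev 8) THE NULL LAW ON THE TAILS —
`μ̃ = 0` ⟺ FLAT (`flatMonomialAt_of_muTilde_zero`, EXACT `flatMonomialAt_iff_muTilde_zero`), NULL TAILS NEVER
INTERFERE (`cleanAt_of_muTilde_zero`,
`null_tail_flat_clean`), THE COINCIDENCE LAW `unclean_io_iff_muTilde_pos`, the null-interference cell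
`NoNullInterferenceSkewStalledTailsDeep` DECIDED
(`noNullInterferenceSkewStalledTailsDeep_holds`), `NoNullFlatSkewStalledTailsDeep`, EXACT `null_iff_nullFlat`, and
the two-leaf exact re-location
`lineFree_iff_positive_nullFlat` / **`skew_iff_positive_nullFlat : CoefficientCut.NoSkewJointTailsDeep ↔
NoPositiveSkewStalledTailsDeep ∧
NoNullFlatSkewStalledTailsDeep`** (hypothesis-free).  0 sorry.  The BY-NAME theorems on `MaxContactCut.DefectWalksDeep` are in
`MaxContactCutStallVertexFlat`.  Imports `StallVertexFlatClasses`.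

[WRITER NOTE (decomp-res writer g9): file split only; namespace, opens, section variables and every declaration
exactly as in the lens (global `set_option` dropped; the lens's `set_option maxHeartbeats … in` lines kept; the
lens's private copy `flat_monomial'` of the landed
`Literature.AlgebraicGeometry.Resolution.PointBlowup.flat_monomial` is cited by its full name, as in `StallVertexCarry`).]

(Sources: KawanoueMatsuki2016 Prop. 4 (2), §4.1; Kawanoue2007 Lemma 2.2.1.2; BierstoneGrigorievMilmanWlodarczyk2011
Def. 3.1.3; Hauser2010; HauserPerlega2024; Moh1987; CossartPiltant2008; Giraud1975; Hironaka1964; ZariskiSamuelII Ch. VIII §2.)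
-/

noncomputable section

open MvPolynomial Finset
open Literature.AlgebraicGeometry.Resolution
open Literature.AlgebraicGeometry.Resolution.Hauser2010
open Literature.AlgebraicGeometry.Resolution.HauserPerlega2024
open Literature.Barriers.ResolutionOfSingularities
open Literature.AlgebraicGeometry.Resolution.PointBlowup
open Summit.ResolutionOfSingularities.ResolutionOfSingularities.Theses
open Summit.ResolutionOfSingularities.ResolutionOfSingularities.Theorems.TightDefectClasses
open Summit.ResolutionOfSingularities.ResolutionOfSingularities.Theorems.ProximityCut
open Summit.ResolutionOfSingularities.ResolutionOfSingularities.Theorems.ExitLaw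
open Summit.ResolutionOfSingularities.ResolutionOfSingularities.Theorems.DifferentialShade

namespace Summit.ResolutionOfSingularities.ResolutionOfSingularities.Theorems.StallVertex

section Classes

/-! ### §4i (rev 8) THE ECHO LAW ON THE TAILS: after an interference the walk translates or changes chart; on a
POSITIVE tail this happens infinitely often -/

/-- **AFTER AN INTERFERENCE THE WALK TRANSLATES OR TURNS** (tail form of `echo_law`).  On a `μ̃`-stalled tail, at every
time `t ≥ N` at which the move is unclean for some `μ_P`-minimiser, the NEXT move changes chart or translates: the
untranslated proximity repeat `(j_{t+1}, b_{t+1}) = (j_t, 0)` — the corner of the new exceptional divisor opposite to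
all older coordinate divisors — is FORBIDDEN right after an interference. [new] [folklore] -/
theorem moves_after_interference {K : Type} [Field K] [DecidableEq K] {p e : ℕ} (hp : p.Prime) [CharP K p]
    {s₀ : State (Fin 3) K} (hs : IsRoot (p ^ e) s₀) (W : ForcedWalk (p ^ e) s₀) (N : ℕ)
    (hstall : ∀ t, N ≤ t → (ifp W (t + 1)).muTilde (p ^ e) = (ifp W t).muTilde (p ^ e))
    (t : ℕ) (ht : N ≤ t) (hunc : ¬ CleanAt W t) :
    W.j (t + 1) ≠ W.j t ∨ ∃ i, W.b (t + 1) i ≠ 0 := by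
  by_contra h
  rw [not_or, not_not, not_exists] at h
  refine hunc (echo_law hp hs W t (hstall t ht) (hstall (t + 1) (by omega)) h.1 fun i => ?_)
  have := h.2 i
  rwa [not_not] at this

/-- **POSITIVE TAILS ECHO INFINITELY OFTEN.**  On a line-free rigid skew stalled tail of POSITIVE differential shade
there are infinitely many times `t` with an INTERFERENCE at `t` immediately followed by a TRANSLATION or a CHART
CHANGE at `t + 1` (`unclean_io_of_muTilde_pos` + `echo_law`): the positive leaf `NoPositiveSkewStalledTailsDeep` is a
statement about the letter pattern around its (forced) interferences. [new] [folklore] -/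
theorem positive_tails_echo (p : ℕ) (hp : p.Prime) (e : ℕ) (he : 2 ≤ e) (K : Type) [Field K] [CharP K p]
    [PerfectField K] [DecidableEq K] (s₀ : State (Fin 3) K) (hs : IsRoot (p ^ e) s₀) (W : ForcedWalk (p ^ e) s₀)
    (hsh : ∀ i, 1 ≤ (W.st i).shade) (N : ℕ) (hplat : ∀ t, N ≤ t → (W.st (t + 1)).shade = (W.st t).shade)
    (hexc : ∀ t, N ≤ t → ordZero (W.st t).F ≠ ((p ^ e : ℕ) : ℕ∞))
    (hS : ∀ M : ℕ, ∃ t, M ≤ t ∧ StaysOnNewest W t) (hT : ∀ M : ℕ, ∃ t, M ≤ t ∧ W.b t ≠ 0)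
    (hskew : ∀ (k : Fin 3) (N' : ℕ), ∃ t, N' ≤ t ∧ (W.j t = k ∨ W.b t k ≠ 0))
    (hstall : ∀ t, N ≤ t → (ifp W (t + 1)).muTilde (p ^ e) = (ifp W t).muTilde (p ^ e))
    (hrig : ∀ t, N ≤ t → VertexLawEqAt W t) (horig : ∀ t, N ≤ t → OriginLawAt W t)
    (hlf : ∀ (s : ℕ) (c : Fin 3 → K), ¬ ContactLineFrom W s c)
    (hpos : (0 : WithTop ℚ) < (ifp W N).muTilde (p ^ e)) :
    ∀ M : ℕ, ∃ t, M ≤ t ∧ ¬ CleanAt W t ∧ (W.j (t + 1) ≠ W.j t ∨ ∃ i, W.b (t + 1) i ≠ 0) := by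
  intro M
  obtain ⟨t, ht, hunc⟩ := unclean_io_of_muTilde_pos p hp e he K s₀ hs W hsh N hplat hexc hS hT hskew hstall hrig
    horig hlf hpos (max N M) (le_max_left _ _)
  exact ⟨t, le_trans (le_max_right _ _) ht, hunc,
    moves_after_interference hp hs W N hstall t (le_trans (le_max_left _ _) ht) hunc⟩

/-! ### §4j (rev 8) THE NULL LAW ON THE TAILS — `μ̃ = 0` ⟺ FLAT, and NULL TAILS NEVER INTERFERE: the two
dichotomies (sign of `μ̃` · clean/unclean) COINCIDE on a stalled tail -/

/-- **THE NULL LAW (walk level)**: `μ̃ = 0` at time `t` forces a FLAT young monomial at `t` — the converse of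
`muTilde_eq_zero_of_flatMonomialAt`. [new] [folklore] -/
theorem flatMonomialAt_of_muTilde_zero {K : Type} [Field K] [DecidableEq K] {q : ℕ} {s₀ : State (Fin 3) K}
    (W : ForcedWalk q s₀) (t : ℕ) (h0 : (ifp W t).muTilde q = 0) : FlatMonomialAt W t := by
  have htop : (ifp W t).muP q ≠ ⊤ := by
    intro htop
    rw [IFPState.muTilde, htop, WithTop.map_top] at h0
    exact WithTop.top_ne_zero h0
  obtain ⟨J₀, hJ₀, hμ, hg⟩ := exists_minimiser W t htop
  obtain ⟨d₀, hd₀⟩ := exists_ordZero_eq_natCast hg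
  have hlev := (level_bounds W t J₀ hJ₀).2
  obtain ⟨S, ρ, hρ, hSdeg, hG, hyoung, hflat⟩ := flat_cone_of_muTilde_zero q (ifp W t) hJ₀ hlev hμ hd₀ h0
  subst hSdeg
  exact ⟨J₀, hJ₀, hμ, S, ρ, hρ, hd₀, hG, hyoung, hflat⟩

/-- **`FLAT ⟺ μ̃ = 0`**, state by state. [new] [folklore] -/
theorem flatMonomialAt_iff_muTilde_zero {K : Type} [Field K] [DecidableEq K] {q : ℕ} {s₀ : State (Fin 3) K}
    (W : ForcedWalk q s₀) (t : ℕ) : FlatMonomialAt W t ↔ (ifp W t).muTilde q = 0 :=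
  ⟨muTilde_eq_zero_of_flatMonomialAt W t, flatMonomialAt_of_muTilde_zero W t⟩

/-- **NULL TAILS NEVER INTERFERE**: a `μ̃`-stalled move from a state with `μ̃ = 0` is CLEAN for every minimiser — the
cone is the flat boundary monomial `u^S` with `u_i^{S_i} ∣ g_{J₀}` at every young letter
(`divisorOrder_eq_of_nondeficient`), and a boundary monomial cone cannot interfere (`clean_of_boundary_cone`). [new]
[folklore] -/
theorem cleanAt_of_muTilde_zero {K : Type} [Field K] [DecidableEq K] {p e : ℕ} (hp : p.Prime) [CharP K p]
    {s₀ : State (Fin 3) K} (hs : IsRoot (p ^ e) s₀) (W : ForcedWalk (p ^ e) s₀) (t : ℕ)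
    (h0 : (ifp W t).muTilde (p ^ e) = 0)
    (hst : (ifp W (t + 1)).muTilde (p ^ e) = (ifp W t).muTilde (p ^ e)) : CleanAt W t := by
  classical
  intro J₀ hJ₀ hμ d₀ hd₀
  have hgne : (ifp W t).gen J₀ ≠ 0 := by
    intro h; rw [h, ordZero_zero] at hd₀; exact ENat.top_ne_coe _ hd₀
  have ha : p ^ e - J₀.degree ≤ d₀ := by
    have := sing_ifp hp hs W t J₀ hJ₀ hgne
    rw [hd₀] at this; exact_mod_cast this
  have hlev := (level_bounds W t J₀ hJ₀).2
  obtain ⟨n, hn⟩ := exists_ordZero_eq_natCast (dirForm_ne_zero (W.j t) (W.b t) hd₀)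
  have hrig := stall_rigid (p ^ e) (W.j t) (W.b t) (W.onExc t) (ifp W t) (fun J hJ => (level_bounds W t J hJ).2)
    (sing_ifp hp hs W t) (by rw [← ifp_succ]; exact hst.symm.le) hJ₀ hμ hd₀
  obtain ⟨-, h2, -, -, -⟩ := hrig
  rw [hn, ENat.toNat_coe] at h2
  obtain ⟨S, ρ, hρ, -, hG, hyoung, hflat⟩ := flat_cone_of_muTilde_zero (p ^ e) (ifp W t) hJ₀ hlev hμ hd₀ h0
  have hSsupp : S ∈ ((ifp W t).gen J₀).support := by
    have h : S ∈ (homogeneousComponent d₀ ((ifp W t).gen J₀)).support := by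
      rw [hG, support_monomial, if_neg hρ]; exact Finset.mem_singleton_self _
    exact mem_support_of_mem_support_homogeneousComponent h
  have hdiv : ∀ i, i ≠ W.j t → W.b t i = 0 → ((S i : ℕ) : ℕ∞) ≤ divisorOrder i ((ifp W t).gen J₀) := by
    intro i _ _
    by_cases hi : i ∈ (ifp W t).young
    · exact (divisorOrder_eq_of_nondeficient (p ^ e) (ifp W t) hJ₀ hlev hSsupp (hflat i hi)).ge
    · have h : S i = 0 := by
        by_contra h; exact hi (hyoung i h)
      rw [h, Nat.cast_zero]; exact zero_le
  exact clean_of_boundary_cone (W.b t) (W.onExc t) ha hd₀ hρ hG hdiv hn h2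

/-- **ON A NULL STALLED TAIL EVERY STATE IS FLAT AND EVERY MOVE IS CLEAN** from the start `N` of the plateau. [new]
[folklore] -/
theorem null_tail_flat_clean {K : Type} [Field K] [DecidableEq K] {p e : ℕ} (hp : p.Prime) [CharP K p]
    {s₀ : State (Fin 3) K} (hs : IsRoot (p ^ e) s₀) (W : ForcedWalk (p ^ e) s₀) (N : ℕ)
    (hstall : ∀ t, N ≤ t → (ifp W (t + 1)).muTilde (p ^ e) = (ifp W t).muTilde (p ^ e))
    (h0 : (ifp W N).muTilde (p ^ e) = 0) (t : ℕ) (ht : N ≤ t) : FlatMonomialAt W t ∧ CleanAt W t := by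
  have h0t : (ifp W t).muTilde (p ^ e) = 0 := by rw [muTilde_eq_of_stall W hstall ht, h0]
  exact ⟨flatMonomialAt_of_muTilde_zero W t h0t, cleanAt_of_muTilde_zero hp hs W t h0t (hstall t ht)⟩

/-- **THE COINCIDENCE LAW**: on a `μ̃`-stalled tail the two dichotomies coincide — the tail is unclean infinitely often
IFF its (settled) differential shade is POSITIVE; it is clean throughout IFF `μ̃ ≡ 0` IFF it is flat throughout.
(`⇐`: `unclean_io_of_muTilde_pos`, which needs the skew/line-free binders; `⇒`: `cleanAt_of_muTilde_zero`.)
[new] [folklore] -/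
theorem unclean_io_iff_muTilde_pos (p : ℕ) (hp : p.Prime) (e : ℕ) (he : 2 ≤ e) (K : Type) [Field K] [CharP K p]
    [PerfectField K] [DecidableEq K] (s₀ : State (Fin 3) K) (hs : IsRoot (p ^ e) s₀) (W : ForcedWalk (p ^ e) s₀)
    (hsh : ∀ i, 1 ≤ (W.st i).shade) (N : ℕ) (hplat : ∀ t, N ≤ t → (W.st (t + 1)).shade = (W.st t).shade)
    (hexc : ∀ t, N ≤ t → ordZero (W.st t).F ≠ ((p ^ e : ℕ) : ℕ∞))
    (hS : ∀ M : ℕ, ∃ t, M ≤ t ∧ StaysOnNewest W t) (hT : ∀ M : ℕ, ∃ t, M ≤ t ∧ W.b t ≠ 0)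
    (hskew : ∀ (k : Fin 3) (N' : ℕ), ∃ t, N' ≤ t ∧ (W.j t = k ∨ W.b t k ≠ 0))
    (hstall : ∀ t, N ≤ t → (ifp W (t + 1)).muTilde (p ^ e) = (ifp W t).muTilde (p ^ e))
    (hrig : ∀ t, N ≤ t → VertexLawEqAt W t) (horig : ∀ t, N ≤ t → OriginLawAt W t)
    (hlf : ∀ (s : ℕ) (c : Fin 3 → K), ¬ ContactLineFrom W s c) :
    (∀ N₁ : ℕ, N ≤ N₁ → ∃ t, N₁ ≤ t ∧ ¬ CleanAt W t) ↔ (0 : WithTop ℚ) < (ifp W N).muTilde (p ^ e) := by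
  constructor
  · intro hI
    by_contra hpos
    have h0 : (ifp W N).muTilde (p ^ e) = 0 :=
      (le_antisymm (not_lt.mp hpos) (muTilde_nonneg W N))
    obtain ⟨t, ht, hunc⟩ := hI N le_rfl
    exact hunc (null_tail_flat_clean hp hs W N hstall h0 t ht).2
  · exact unclean_io_of_muTilde_pos p hp e he K s₀ hs W hsh N hplat hexc hS hT hskew hstall hrig horig hlf

/-- The INTERFERENCE sub-leaf of the null leaf: `μ̃ ≡ 0` AND unclean infinitely often. -/
def NoNullInterferenceSkewStalledTailsDeep : Prop :=
  ∀ p : ℕ, p.Prime → ∀ e : ℕ, 2 ≤ e → ∀ (K : Type) [Field K] [CharP K p] [PerfectField K] [DecidableEq K]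
    (s₀ : State (Fin 3) K), IsRoot (p ^ e) s₀ → ∀ W : ForcedWalk (p ^ e) s₀, (∀ i, 1 ≤ (W.st i).shade) →
    ∀ N : ℕ, (∀ t, N ≤ t → (W.st (t + 1)).shade = (W.st t).shade) →
    (∀ t, N ≤ t → ordZero (W.st t).F ≠ ((p ^ e : ℕ) : ℕ∞)) →
    (∀ M : ℕ, ∃ t, M ≤ t ∧ StaysOnNewest W t) → (∀ M : ℕ, ∃ t, M ≤ t ∧ W.b t ≠ 0) →
    (∀ (k : Fin 3) (N' : ℕ), ∃ t, N' ≤ t ∧ (W.j t = k ∨ W.b t k ≠ 0)) →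
    (∀ t, N ≤ t → (ifp W (t + 1)).muTilde (p ^ e) = (ifp W t).muTilde (p ^ e)) →
    (∀ t, N ≤ t → VertexLawEqAt W t) → (∀ t, N ≤ t → OriginLawAt W t) →
    (∀ (s : ℕ) (c : Fin 3 → K), ¬ ContactLineFrom W s c) →
    (∀ t, N ≤ t → (ifp W t).muTilde (p ^ e) = 0) →
    (∀ N₁ : ℕ, N ≤ N₁ → ∃ t, N₁ ≤ t ∧ ¬ CleanAt W t) → False

/-- **THE NULL-INTERFERENCE SUB-LEAF IS EMPTY** (`cleanAt_of_muTilde_zero`; none of the skew / line-free binders is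
used). [new] [folklore] -/
theorem noNullInterferenceSkewStalledTailsDeep_holds : NoNullInterferenceSkewStalledTailsDeep := by
  intro p hp e _ K _ _ _ _ s₀ hs W _ N _ _ _ _ _ hstall _ _ _ h0 hI
  obtain ⟨t, ht, hunc⟩ := hI N le_rfl
  exact hunc (cleanAt_of_muTilde_zero hp hs W t (h0 t ht) (hstall t ht))

/-- The NULL leaf with its disjunction COLLAPSED: `μ̃ ≡ 0`, clean and flat at EVERY `t ≥ N` (both now consequences of
`μ̃ ≡ 0`, kept as binders for the reader: Kawanoue–Matsuki's monomial case from the start of the plateau). -/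
def NoNullFlatSkewStalledTailsDeep : Prop :=
  ∀ p : ℕ, p.Prime → ∀ e : ℕ, 2 ≤ e → ∀ (K : Type) [Field K] [CharP K p] [PerfectField K] [DecidableEq K]
    (s₀ : State (Fin 3) K), IsRoot (p ^ e) s₀ → ∀ W : ForcedWalk (p ^ e) s₀, (∀ i, 1 ≤ (W.st i).shade) →
    ∀ N : ℕ, (∀ t, N ≤ t → (W.st (t + 1)).shade = (W.st t).shade) →
    (∀ t, N ≤ t → ordZero (W.st t).F ≠ ((p ^ e : ℕ) : ℕ∞)) →
    (∀ M : ℕ, ∃ t, M ≤ t ∧ StaysOnNewest W t) → (∀ M : ℕ, ∃ t, M ≤ t ∧ W.b t ≠ 0) →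
    (∀ (k : Fin 3) (N' : ℕ), ∃ t, N' ≤ t ∧ (W.j t = k ∨ W.b t k ≠ 0)) →
    (∀ t, N ≤ t → (ifp W (t + 1)).muTilde (p ^ e) = (ifp W t).muTilde (p ^ e)) →
    (∀ t, N ≤ t → VertexLawEqAt W t) → (∀ t, N ≤ t → OriginLawAt W t) →
    (∀ (s : ℕ) (c : Fin 3 → K), ¬ ContactLineFrom W s c) →
    (∀ t, N ≤ t → (ifp W t).muTilde (p ^ e) = 0) →
    (∀ t, N ≤ t → CleanAt W t) → (∀ t, N ≤ t → FlatMonomialAt W t) → False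

/-- **THE NULL LEAF COLLAPSES**: its interference alternative is empty and its flat alternative starts at `N₁ =
N`. [folklore] -/
theorem null_iff_nullFlat : NoNullSkewStalledTailsDeep ↔ NoNullFlatSkewStalledTailsDeep := by
  constructor
  · intro h p hp e he K _ _ _ _ s₀ hs W hsh N hplat hexc hS hT hskew hstall hrig horig hlf h0 hcl hfl
    exact h p hp e he K s₀ hs W hsh N hplat hexc hS hT hskew hstall hrig horig hlf h0 (Or.inr ⟨N, le_rfl, hcl, hfl⟩)
  · intro h p hp e he K _ _ _ _ s₀ hs W hsh N hplat hexc hS hT hskew hstall hrig horig hlf h0 _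
    exact h p hp e he K s₀ hs W hsh N hplat hexc hS hT hskew hstall hrig horig hlf h0
      (fun t ht => (null_tail_flat_clean hp hs W N hstall (h0 N le_rfl) t ht).2)
      (fun t ht => (null_tail_flat_clean hp hs W N hstall (h0 N le_rfl) t ht).1)

/-- **THE RESIDUAL IS EXACTLY «POSITIVE (= INTERFERENCE) TAILS ∧ NULL (= FLAT, CLEAN) TAILS»**: the located residual
of rev 5/6 splits by the settled sign of `μ̃` into two PURE leaves with no cross terms. [folklore] -/
theorem lineFree_iff_positive_nullFlat :
    NoLineFreeRigidSkewStalledTailsDeep ↔ NoPositiveSkewStalledTailsDeep ∧ NoNullFlatSkewStalledTailsDeep := by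
  rw [lineFree_iff_flat, flat_iff_positiveInterference_null, positiveInterference_iff_positive, null_iff_nullFlat]

/-- `skew_iff_positive_nullFlat`: Auxiliary step of this node's calculus, VERBATIM from the lens file (see the
module docstring); the statement is its type. [folklore] -/
theorem skew_iff_positive_nullFlat :
    CoefficientCut.NoSkewJointTailsDeep ↔ NoPositiveSkewStalledTailsDeep ∧ NoNullFlatSkewStalledTailsDeep := by
  rw [skew_iff_flat, flat_iff_positiveInterference_null, positiveInterference_iff_positive, null_iff_nullFlat]

end Classes

end Summit.ResolutionOfSingularities.ResolutionOfSingularities.Theorems.StallVertex
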